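import Literature.Geometry.Lorentzian.CurvatureNaturality
import Literature.Geometry.Lorentzian.MetricValCongr
import Literature.Geometry.Lorentzian.HypersurfaceRestriction
import Literature.Geometry.Lorentzian.IsometryProofs
import Literature.Geometry.Lorentzian.LeviCivitaProofs
import Literature.Geometry.Riemannian.IsotropicCurvature
import Literature.Geometry.Riemannian.ConformalIsotropicCurvature
import Literature.Geometry.Riemannian.RoundSphereProofs
import Summits.SmoothPoincare4.SmoothPoincare4.Theses.IsotropicCorkBracketing
import Literature.Geometry.Riemannian.NeumannIsotropicFormPos
import Literature.Topology.FourManifolds.KnotFraming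
import Literature.Topology.FourManifolds.InteriorConnected

/-!
# Route `IsotropicCorkBracketing`, item `RoundSideGivesBracketing` (stmt-SmoothPoincare4-9833):
# `CorkSideIsotropicFillIn → CorkIsotropicBracketing`

The one-sided crux `CorkSideIsotropicFillIn` provides, for a cork twist `P = C ∪_(φ∘τ) W` of
`S⁴ = C ∪_φ W`, a Riemannian metric `G` on `P` which is Neumann-isotropic-positive on the cork
piece `jC(C)` and ROUND on the exterior piece (`G = f^*⟨·,·⟩_{ℝ⁵}` on `T_pP` for `p ∈ jW(W)`,
`f : P → S⁴` smooth with `f ∘ jW = kW`). This file proves that such a `G` is automatically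
Neumann-isotropic-positive on the exterior piece `jW(W)` as well, with `μ` the minimal isotropic
curvature of `G` and `c = 12`, which is exactly the second clause of `CorkIsotropicBracketing`.

* `curvatureForm_eq_of_val_eq_pullbackBilin`, `isotropicCurvature_eq_of_val_eq_pullbackBilin` —
  the covariant curvature tensor / the isotropic curvature under a local isometry defined on an
  open set (O'Neill 1983, Ch. 3, Prop. 3.59, localized exactly as the tree's
  `scalarCurvature_eq_of_val_eq_pullbackBilin`: restrict to the open submanifold, compare the two
  honest `comap` metrics by `curvatureForm_congr_of_val_eq`, and use naturality
  `curvatureForm_comap_leviCivita` on both sides);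
* `isotropicCurvature_roundMetric_of_isOrthonormalFrame` — the unit round sphere has isotropic
  curvature `4` on orthonormal `4`-frames (`R(X,Y)Z = ⟨Y,Z⟩X − ⟨X,Z⟩Y`, the tree's
  `curvature_roundMetric`; Micallef–Moore 1988, §1);
* `roundSideGivesBracketing_proof` — the route item, verbatim. On the open piece
  `U = (range jC)ᶜ ⊆ jW(W)` the metric is the pullback of the round metric along `f`, whose
  differential is injective on `jW(W)` (`dkW = df ∘ djW`, `dkW` injective, `djW` bijective), so
  the minimal isotropic curvature `m_G` (continuous, `continuous_minIsotropicCurvature`) is `≡ 4`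
  on `U`, hence on `closure U ⊇ jW(W)` (the interior of `W` is dense, `dense_interior`, and is
  mapped into `U` by the gluing relation); then `12 ∫_{jW(W)} u² ≤ ∫_{jW(W)} (6|∇u|² + 3 m_G u²)`.

## References

* B. O'Neill, *Semi-Riemannian geometry* (1983), Ch. 3, Prop. 3.59, pp. 90–91. [ONeill1983]
* M. Micallef, J. D. Moore, Ann. of Math. 127 (1988) 199–227, §1. [MicallefMoore1988]
* B.-L. Chen, X.-P. Zhu, Comm. Anal. Geom. 22 (2014), arXiv:1206.5051, (2.8), §3. [ChenZhu2014]
-/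

noncomputable section

-- the prescribed namespace `Summit.<P>.<Sub>.…` duplicates `SmoothPoincare4` (P = Sub)
set_option linter.dupNamespace false

open Bundle Set Function Filter
open scoped Manifold ContDiff Topology InnerProductSpace
-- Mathlib's scoped instance `Fact (finrank ℝ (EuclideanSpace ℝ (Fin n)) = n)`, feeding the
-- `[Fact (finrank ℝ V = n + 1)]` hypotheses of the sphere API
open scoped EuclideanSpace

namespace Summit.SmoothPoincare4.SmoothPoincare4.Theorems

namespace RoundSideGivesBracketing

open Literature.Geometry.Lorentzian Literature.Geometry.Lorentzian.PseudoRiemannianMetric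

section LocalIsometry

variable {EP : Type*} [NormedAddCommGroup EP] [NormedSpace ℝ EP] {HP : Type*} [TopologicalSpace HP]
  {J : ModelWithCorners ℝ EP HP} {P : Type*} [TopologicalSpace P] [ChartedSpace HP P]
  [IsManifold J ∞ P]
  {EX : Type*} [NormedAddCommGroup EX] [NormedSpace ℝ EX] {HX : Type*} [TopologicalSpace HX]
  {IX : ModelWithCorners ℝ EX HX} {X : Type*} [TopologicalSpace X] [ChartedSpace HX X]
  [IsManifold IX ∞ X]
  [FiniteDimensional ℝ EP] [FiniteDimensional ℝ EX] [CompleteSpace EP] [CompleteSpace EX]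
  (g : PseudoRiemannianMetric J ∞ EP (TangentSpace J : P → Type _)) [g.HasLeviCivita]
  (G : PseudoRiemannianMetric IX ∞ EX (TangentSpace IX : X → Type _)) [G.HasLeviCivita]

/-- **The covariant curvature tensor under a local isometry defined on an open set** (O'Neill
1983, Ch. 3, Prop. 3.59, localized; the `Rm` companion of the tree's
`scalarCurvature_eq_of_val_eq_pullbackBilin`): let `E : X → P` be `C^∞` with injective
differential at every point of an open set `U ⊆ X`, `dim X = dim P`, and suppose the metric `G` of
`X` agrees on `U` with the pullback of `g`: `G_q(v, w) = g_{E q}(dE v, dE w)` for `q ∈ U`. Then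
`Rm_G(q)(X₀, Y₀, Z₀, W₀) = Rm_g(E q)(dE X₀, dE Y₀, dE Z₀, dE W₀)` for every `q ∈ U`. Proof: on the
open submanifold `U` the restrictions `G|_U` and `(E|_U)^* g` are honest pullback metrics with the
same values; apply naturality of `Rm` under `comap` on both sides. -/
theorem curvatureForm_eq_of_val_eq_pullbackBilin {E : X → P} {U : Set X} (hU : IsOpen U)
    (hE : ∀ q ∈ U, ContMDiffAt IX J ∞ E q)
    (hEinj : ∀ q ∈ U, Function.Injective (mfderiv IX J E q))
    (hdim : Module.finrank ℝ EX = Module.finrank ℝ EP)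
    (hval : ∀ q ∈ U, G.val q = pullbackBilin (I := J) (I' := IX) E g.val q)
    {q : X} (hq : q ∈ U) (X₀ Y₀ Z₀ W₀ : TangentSpace IX q) :
    G.curvatureForm G.leviCivita q X₀ Y₀ Z₀ W₀ =
      g.curvatureForm g.leviCivita (E q) (mfderiv IX J E q X₀) (mfderiv IX J E q Y₀)
        (mfderiv IX J E q Z₀) (mfderiv IX J E q W₀) := by
  set W : TopologicalSpace.Opens X := ⟨U, hU⟩ with hW
  -- the two honest pullback metrics on the open submanifold `W`
  set Φ : W → P := E ∘ Subtype.val with hΦdef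
  have hΦ : ContMDiff IX J (∞ + 1) Φ := fun u ↦
    (hE u.1 u.2).comp u (contMDiff_subtype_val u)
  have hEu : ∀ u : W, MDifferentiableAt IX J E u.1 := fun u ↦
    (hE u.1 u.2).mdifferentiableAt (by simp)
  have hΦ' : ∀ u, Function.Injective (mfderiv IX J Φ u) := fun u ↦ by
    rw [hΦdef, mfderiv_comp_subtypeVal (hEu u)]
    exact hEinj u.1 u.2
  have hι : ContMDiff IX IX (∞ + 1) (Subtype.val : W → X) := contMDiff_subtype_val
  have hι' : ∀ u : W, Function.Injective (mfderiv IX IX (Subtype.val : W → X) u) := fun u ↦ by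
    rw [mfderiv_subtypeVal]
    exact fun v w h ↦ h
  set gΦ := g.comap (contMDiff_pullbackBilin_holds (I := J) (M := P) (I' := IX) (N := W)) Φ hΦ
    hΦ' hdim with hgΦ
  set GW := G.comap (contMDiff_pullbackBilin_holds (I := IX) (M := X) (I' := IX) (N := W))
    Subtype.val hι hι' rfl with hGW
  haveI := gΦ.hasLeviCivita
  haveI := GW.hasLeviCivita
  -- they have the same values
  have hvals : ∀ u : W, gΦ.val u = GW.val u := by
    intro u
    refine ContinuousLinearMap.ext fun v ↦ ContinuousLinearMap.ext fun w ↦ ?_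
    show pullbackBilin (I := J) (I' := IX) Φ g.val u v w =
      pullbackBilin (I := IX) (I' := IX) (Subtype.val : W → X) G.val u v w
    rw [pullbackBilin_apply, pullbackBilin_apply, hΦdef, mfderiv_comp_subtypeVal (hEu u),
      mfderiv_subtypeVal, hval u.1 u.2, pullbackBilin_apply]
    rfl
  have h1 : gΦ.curvatureForm gΦ.leviCivita ⟨q, hq⟩ X₀ Y₀ Z₀ W₀ =
      g.curvatureForm g.leviCivita (Φ ⟨q, hq⟩) (mfderiv IX J Φ ⟨q, hq⟩ X₀)
        (mfderiv IX J Φ ⟨q, hq⟩ Y₀) (mfderiv IX J Φ ⟨q, hq⟩ Z₀) (mfderiv IX J Φ ⟨q, hq⟩ W₀) :=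
    g.curvatureForm_comap_leviCivita _ hΦ hΦ' hdim ⟨q, hq⟩ X₀ Y₀ Z₀ W₀
  have h2 : GW.curvatureForm GW.leviCivita ⟨q, hq⟩ X₀ Y₀ Z₀ W₀ =
      G.curvatureForm G.leviCivita q X₀ Y₀ Z₀ W₀ := by
    have h := G.curvatureForm_comap_leviCivita _ hι hι' rfl ⟨q, hq⟩ X₀ Y₀ Z₀ W₀
    rw [mfderiv_subtypeVal] at h
    exact h
  rw [← h2, ← curvatureForm_congr_of_val_eq hvals ⟨q, hq⟩, h1, hΦdef,
    mfderiv_comp_subtypeVal (hEu ⟨q, hq⟩)]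
  rfl

/-- **The isotropic curvature under a local isometry defined on an open set**: with the data of
`curvatureForm_eq_of_val_eq_pullbackBilin`, `K_iso^G_q(e) = K_iso^g_{E q}(dE ∘ e)` for every
4-frame `e` at `q ∈ U`. -/
theorem isotropicCurvature_eq_of_val_eq_pullbackBilin {E : X → P} {U : Set X} (hU : IsOpen U)
    (hE : ∀ q ∈ U, ContMDiffAt IX J ∞ E q)
    (hEinj : ∀ q ∈ U, Function.Injective (mfderiv IX J E q))
    (hdim : Module.finrank ℝ EX = Module.finrank ℝ EP)
    (hval : ∀ q ∈ U, G.val q = pullbackBilin (I := J) (I' := IX) E g.val q)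
    {q : X} (hq : q ∈ U) (e : Fin 4 → TangentSpace IX q) :
    G.isotropicCurvature G.leviCivita q e =
      g.isotropicCurvature g.leviCivita (E q) (fun i ↦ mfderiv IX J E q (e i)) := by
  simp only [isotropicCurvature,
    curvatureForm_eq_of_val_eq_pullbackBilin g G hU hE hEinj hdim hval hq]

omit [FiniteDimensional ℝ EP] [FiniteDimensional ℝ EX] [CompleteSpace EP] [CompleteSpace EX]
  [g.HasLeviCivita] [G.HasLeviCivita] in
/-- Orthonormal frames correspond under a pointwise isometry: if `G_q = E^* g` at `q` then `e` is
`G_q`-orthonormal iff `dE ∘ e` is `g_{E q}`-orthonormal. -/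
theorem isOrthonormalFrame_iff_of_val_eq_pullbackBilin {E : X → P} {q : X}
    (hval : G.val q = pullbackBilin (I := J) (I' := IX) E g.val q) {ι : Type*}
    (e : ι → TangentSpace IX q) :
    G.IsOrthonormalFrame q e ↔ g.IsOrthonormalFrame (E q) (fun i ↦ mfderiv IX J E q (e i)) := by
  simp only [IsOrthonormalFrame, hval, pullbackBilin_apply]

end LocalIsometry

/-! ### The round `S⁴` has isotropic curvature `4` on orthonormal frames -/

section Round

open Literature.Geometry.Riemannian

variable (V : Type*) [NormedAddCommGroup V] [InnerProductSpace ℝ V] {m : ℕ}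
  [Fact (Module.finrank ℝ V = m + 1)]

/-- **The round unit sphere has isotropic curvature `4` on every orthonormal `4`-frame**, for any
Levi-Civita connection of the round metric: by the Gauss-equation computation
`R(X,Y)Z = g(Y,Z)X − g(X,Z)Y` (`curvature_roundMetric`) each of the four sectional terms
`Rm(eᵢ,eⱼ,eⱼ,eᵢ)` is `1` and the mixed term `Rm(e₁,e₂,e₄,e₃)` vanishes. -/
theorem isotropicCurvature_roundMetric_of_isOrthonormalFrame
    {cov : CovariantDerivative (𝓡 m) (EuclideanSpace ℝ (Fin m))
      (TangentSpace (𝓡 m) : Metric.sphere (0 : V) 1 → Type _)}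
    (h : (roundMetric (n := m) V).IsLeviCivita cov) (x : Metric.sphere (0 : V) 1)
    {e : Fin 4 → TangentSpace (𝓡 m) x} (he : (roundMetric (n := m) V).IsOrthonormalFrame x e) :
    (roundMetric (n := m) V).isotropicCurvature cov x e = 4 := by
  have hK : ∀ X Y Z W : TangentSpace (𝓡 m) x,
      (roundMetric (n := m) V).curvatureForm cov x X Y Z W =
        (roundMetric (n := m) V).val x Y Z * (roundMetric (n := m) V).val x X W -
          (roundMetric (n := m) V).val x X Z * (roundMetric (n := m) V).val x Y W := by
    intro X Y Z W
    rw [curvatureForm, curvature_roundMetric h x X Y Z, map_sub, map_smul, map_smul]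
    simp only [_root_.sub_apply, _root_.smul_apply, smul_eq_mul]
  simp only [isotropicCurvature, hK, he.1, he.2 0 2 (by decide), he.2 0 3 (by decide),
    he.2 1 2 (by decide), he.2 1 3 (by decide), he.2 2 0 (by decide), he.2 3 0 (by decide),
    he.2 2 1 (by decide), he.2 3 1 (by decide)]
  norm_num

end Round


/-! ### Nonnegativity of the gradient square -/

section GradSq

/-- For a Riemannian metric the gradient square is non-negative: `|∇ψ|²_g = g(♯dψ, ♯dψ) ≥ 0`.
(Restated from the tree's `PseudoRiemannianMetric.gradSq_nonneg` to keep the imports light.) -/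
theorem gradSq_nonneg' {E : Type*} [NormedAddCommGroup E] [NormedSpace ℝ E] {H : Type*}
    [TopologicalSpace H] {I : ModelWithCorners ℝ E H} {M : Type*} [TopologicalSpace M]
    [ChartedSpace H M] [IsManifold I ∞ M] {n : ℕ∞ω} [FiniteDimensional ℝ E]
    (g : PseudoRiemannianMetric I n E (TangentSpace I : M → Type _)) (hg : g.IsRiemannian)
    (ψ : M → ℝ) (x : M) : 0 ≤ g.gradSq ψ x := by
  rw [PseudoRiemannianMetric.gradSq, PseudoRiemannianMetric.innerDual_eq_val_sharp_sharp]
  by_cases h : g.sharp x (mvfderiv I ψ x : TangentSpace I x →ₗ[ℝ] ℝ) = 0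
  · rw [h]; simp
  · exact (hg x _ h).le

end GradSq

end RoundSideGivesBracketing

/-! ### The route item -/

section Main

open Literature.Geometry.Lorentzian Literature.Geometry.Lorentzian.PseudoRiemannianMetric
open Literature.Geometry.Riemannian MeasureTheory RoundSideGivesBracketing
open Summit.SmoothPoincare4.SmoothPoincare4.Theses.IsotropicCorkBracketing

/-- **Route item `RoundSideGivesBracketing` (stmt-SmoothPoincare4-9833): `CorkSideIsotropicFillIn →
CorkIsotropicBracketing`.** Given the cork data, `CorkSideIsotropicFillIn` provides a Riemannian
metric `G` on the twisted gluing `P = C ∪ W` which is Neumann-isotropic-positive on the cork piece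
`jC(C)` and ROUND on the exterior piece: `G = f^*⟨·,·⟩_{ℝ⁵}` on `T_pP`, `p ∈ jW(W)`, for a smooth
`f : P → S⁴` with `f ∘ jW = kW`. On the open piece `U = (range jC)ᶜ ⊆ jW(W)` the metric `G` is
the pullback of the round metric along the local diffeomorphism `f` (`df` is injective on `jW(W)`:
`dkW = df ∘ djW` with `dkW` injective and `djW` bijective), so by naturality of the curvature under
local isometries (O'Neill 1983, Prop. 3.59) every `G`-orthonormal `4`-frame there has isotropic
curvature `4` (that of the unit round sphere, `R(X,Y)Z = ⟨Y,Z⟩X − ⟨X,Z⟩Y`); the minimal isotropic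
curvature `m_G` (continuous, `continuous_minIsotropicCurvature`) is therefore `≡ 4` on `U`, hence
on its closure, which contains `jW(W)` (the interior of `W` is dense and maps into `U`). With
`μ = m_G` and `c = 12`: `12 ∫_{jW(W)} u² ≤ ∫_{jW(W)} (6|∇u|² + 3 m_G u²)` since `|∇u|² ≥ 0`. -/
theorem roundSideGivesBracketing_proof :
    Summit.SmoothPoincare4.SmoothPoincare4.Theses.IsotropicCorkBracketing.RoundSideGivesBracketing := by
  intro hFill C _ _ _ _ _ _ _ ZC _ _ _ ιC hιC hιCr W _ _ _ _ _ _ ZW _ _ _ ιW hιW hιWr φ τ hS P _ _ _ _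
    _ _ _ _ jC jW hjC hjW hjcov hjglue
  obtain ⟨kC, kW, hkC, hkW, hkcov, hkglue⟩ := hS
  obtain ⟨G, hG, hLC, ⟨f, hf, hfjW, hGval⟩, hCside⟩ :=
    hFill C ZC ιC hιC hιCr W ZW ιW hιW hιWr φ τ kC kW hkC hkW hkcov hkglue P jC jW hjC hjW hjcov
      hjglue
  refine ⟨G, hG, hLC, hCside, ?_⟩
  haveI := hLC
  -- the round metric of the target sphere
  set gR : PseudoRiemannianMetric (𝓡 4) ∞ (EuclideanSpace ℝ (Fin 4))
      (TangentSpace (𝓡 4) : Metric.sphere (0 : EuclideanSpace ℝ (Fin 5)) 1 → Type _) :=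
    roundMetric (n := 4) (EuclideanSpace ℝ (Fin 5)) with hgR
  haveI : gR.HasLeviCivita := gR.hasLeviCivita
  -- the open piece `U = (range jC)ᶜ ⊆ range jW`
  set U : Set P := (Set.range jC)ᶜ with hU_def
  have hUo : IsOpen U := (isCompact_range hjC.contMDiff.continuous).isClosed.isOpen_compl
  have hUW : U ⊆ Set.range jW := fun x hx ↦ by
    have hx' : x ∈ Set.range jC ∪ Set.range jW := hjcov ▸ Set.mem_univ x
    exact hx'.resolve_left hx
  -- differentiability
  have hfd : ∀ x, MDifferentiableAt (𝓡 4) (𝓡 4) f x := fun x ↦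
    (hf x).mdifferentiableAt (by simp)
  have hvald : ∀ y : Metric.sphere (0 : EuclideanSpace ℝ (Fin 5)) 1,
      MDifferentiableAt (𝓡 4) 𝓘(ℝ, EuclideanSpace ℝ (Fin 5))
        (Subtype.val : Metric.sphere (0 : EuclideanSpace ℝ (Fin 5)) 1 → EuclideanSpace ℝ (Fin 5))
        y := fun y ↦
    (contMDiff_coe_sphere (m := ∞) (n := 4) (E := EuclideanSpace ℝ (Fin 5)) y).mdifferentiableAt
      (by simp)
  -- the metric identity `G = f^* g_round` on `range jW`
  have hval : ∀ x ∈ Set.range jW, G.val x = pullbackBilin (I := 𝓡 4) (I' := 𝓡 4) f gR.val x := by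
    rintro _ ⟨b, rfl⟩
    refine ContinuousLinearMap.ext fun v ↦ ContinuousLinearMap.ext fun v' ↦ ?_
    rw [hGval b v v', pullbackBilin_apply, hgR, roundMetric_apply,
      mfderiv_comp (jW b) (hvald _) (hfd _)]
    rfl
  -- `df` is injective on `range jW`
  have hfinj : ∀ x ∈ Set.range jW, Injective (mfderiv (𝓡 4) (𝓡 4) f x) := by
    rintro _ ⟨b, rfl⟩
    have h1 : Injective (mfderiv (𝓡∂ 4) (𝓡 4) kW b) :=
      Literature.Topology.FourManifolds.Manifold.IsImmersionAt.mfderiv_injective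
        (hkW.isImmersion.isImmersionAt b) (by simp)
    have h2 : Injective (mfderiv (𝓡∂ 4) (𝓡 4) jW b) :=
      Literature.Topology.FourManifolds.Manifold.IsImmersionAt.mfderiv_injective
        (hjW.isImmersion.isImmersionAt b) (by simp)
    haveI : FiniteDimensional ℝ (TangentSpace (𝓡∂ 4) b) :=
      inferInstanceAs (FiniteDimensional ℝ (EuclideanSpace ℝ (Fin 4)))
    have h2' : Surjective (mfderiv (𝓡∂ 4) (𝓡 4) jW b) :=
      (LinearMap.injective_iff_surjective (f := (mfderiv (𝓡∂ 4) (𝓡 4) jW b).toLinearMap)).1 h2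
    have hkf : kW = f ∘ jW := funext fun w ↦ (hfjW w).symm
    rw [hkf, mfderiv_comp b (hfd _) ((hjW.contMDiff b).mdifferentiableAt (by simp))] at h1
    exact (show Injective ((mfderiv (𝓡 4) (𝓡 4) f (jW b)) ∘ (mfderiv (𝓡∂ 4) (𝓡 4) jW b)) from
      h1).of_comp_right h2'
  -- isotropic curvature `4` on `U`
  have hiso : ∀ x ∈ U, ∀ e : Fin 4 → TangentSpace (𝓡 4) x, G.IsOrthonormalFrame x e →
      G.isotropicCurvature G.leviCivita x e = 4 := by
    intro x hx e he
    rw [isotropicCurvature_eq_of_val_eq_pullbackBilin gR G hUo (fun q _ ↦ hf q)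
      (fun q hq ↦ hfinj q (hUW hq)) rfl (fun q hq ↦ hval q (hUW hq)) hx e]
    exact isotropicCurvature_roundMetric_of_isOrthonormalFrame (EuclideanSpace ℝ (Fin 5))
      isLeviCivita_leviCivita_holds (f x)
      ((isOrthonormalFrame_iff_of_val_eq_pullbackBilin gR G (hval x (hUW hx)) e).1 he)
  have hmin : ∀ x ∈ U, minIsotropicCurvature G x = 4 := by
    intro x hx
    obtain ⟨e, he, heq⟩ := exists_isotropicCurvature_eq_minIsotropicCurvature hG x
    rw [← heq]
    exact hiso x hx e he
  -- `range jW ⊆ closure U`: the interior of `W` is dense and is mapped into `U`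
  have hsub : (𝓡∂ 4).interior W ⊆ jW ⁻¹' U := by
    intro b hb
    simp only [Set.mem_preimage, hU_def, Set.mem_compl_iff]
    rintro ⟨a, ha⟩
    obtain ⟨z, -, hz⟩ := (hjglue a b).1 ha
    have hbd : b ∈ (𝓡∂ 4).boundary W := by
      rw [← hιWr]
      exact ⟨_, hz.symm⟩
    exact Set.disjoint_left.1 ModelWithCorners.disjoint_interior_boundary hb hbd
  have hcl : Set.range jW ⊆ closure U := by
    rintro _ ⟨b, rfl⟩
    have hb : b ∈ closure ((𝓡∂ 4).interior W) :=
      Literature.Topology.FourManifolds.dense_interior (I := 𝓡∂ 4) (M := W) b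
    have h1 : jW b ∈ closure (jW '' (𝓡∂ 4).interior W) :=
      image_closure_subset_closure_image hjW.contMDiff.continuous ⟨b, hb, rfl⟩
    exact closure_mono (Set.image_subset_iff.2 hsub) h1
  have hmin4 : ∀ x ∈ Set.range jW, minIsotropicCurvature G x = 4 := by
    have hclosed : IsClosed {x | minIsotropicCurvature G x = 4} :=
      isClosed_eq (continuous_minIsotropicCurvature hG) continuous_const
    intro x hx
    exact (hclosed.closure_subset_iff.2 hmin) (hcl hx)
  -- the Neumann inequality on `range jW` with `μ = minIsotropicCurvature G`, `c = 12`
  refine ⟨12, by norm_num, minIsotropicCurvature G, continuous_minIsotropicCurvature hG,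
    fun _ _ he ↦ minIsotropicCurvature_le hG he, fun u hu ↦ ?_⟩
  haveI := isFiniteMeasure_riemannianMeasure_of_compactSpace G hG
  have huc : Continuous u := hu.continuous
  have hgrad : Continuous (G.gradSq u) := continuous_innerDual_mvfderiv G hu hu
  have hminc : Continuous (minIsotropicCurvature G) := continuous_minIsotropicCurvature hG
  have hint : ∀ {F : P → ℝ}, Continuous F →
      Integrable F (riemannianMeasure (G.toContMDiffRiemannianMetric hG)) := fun hF ↦
    integrableOn_univ.1 (hF.continuousOn.integrableOn_compact' isCompact_univ MeasurableSet.univ)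
  have hmeas : MeasurableSet (Set.range jW) :=
    (isCompact_range hjW.contMDiff.continuous).isClosed.measurableSet
  rw [← integral_const_mul]
  refine setIntegral_mono_on (hint (by fun_prop)).integrableOn (hint (by fun_prop)).integrableOn
    hmeas fun x hx ↦ ?_
  rw [hmin4 x hx]
  have h0 : 0 ≤ G.gradSq u x := gradSq_nonneg' G hG u x
  nlinarith [sq_nonneg (u x)]

end Main

end Summit.SmoothPoincare4.SmoothPoincare4.Theorems
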